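import Summits.Ventures.PercRepro.S2SharpPairs
import Summits.Ventures.PercRepro.S2SquareMultiplicity3B

/-!
# PercRepro — S2: THE GIANT-FLAT PARTITION COUNT WITH THE CIRCUIT REMOVED FROM THE PAIR FACTORS (p7, gen 3; sub-claim S2)

`S2.ncard_eRk_eq_ncard_le_le_giant_three'` (S2SquareGiantCount3, the partition form on the multiplicity `ν + 3·C(ν, 2)`)
with the pair counts of S2SharpPairs: the pairs `(C, B′)` number at most `Σ_k s_k·C(n − k, q + 1 − k)` and the giant
pairs at most `Σ_k s_k·C(F_max − k, q + 1 − k)` (`B′` avoids its circuit). The proof is that of the `'` form line for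
line; only the two pair bounds change:
`#{B ⊆ E : r(B) = q, |B| ≤ d} ≤ C(n, q) + σ_m·P′_E + (σ_g − σ_s)·P′_{F_max}`, `P′_S = Σ_k s_k·C(|S| − k, q + 1 − k)`.
Generic in `q`. Axioms: standard.
-/

open scoped Matroid

namespace PercRepro

namespace S2

open Set Finset

variable {α : Type} {M : Matroid α}

open scoped Classical in
/-- **THE PARTITION COUNT WITH THE CIRCUIT REMOVED FROM THE PAIR FACTORS** (`card_pairsF_le'` / `card_pairsGiant_le'`): the small, mid and giant pairs PARTITION the pairs, so
with `σ_s ≤ σ_m` and `σ_s ≤ σ_g` (termwise: `f′ − q ≤ min(f − q − 1, ν₁ − 2)` and `f′ − q ≤ F_max − q − 1`)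
`#{B ⊆ E : r(B) = q, |B| ≤ d} ≤ C(n, q) + σ_m·P_E + (σ_g − σ_s)·P_{F_max}` — the mid weight on ALL pairs, the giant
excess on the giant pairs only (no `S₀` term). -/
theorem ncard_eRk_eq_ncard_le_le_giant_three_S (M : Matroid α) [M.Finite] (q f f' ν₁ νi : ℕ) (hq : 1 ≤ q)
    (hcirc : ∀ C, M.IsCircuit C → 3 ≤ C.encard) (hC1 : ∀ L ⊆ M.E, M.eRk L = 2 → L.ncard ≤ 3)
    (hflat : ∀ X ⊆ M.E, M.eRk X ≤ q → X.ncard ≤ f)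
    (hflat' : ∀ X ⊆ M.E, M.eRk X ≤ (q - 1 : ℕ) → X.ncard ≤ f')
    (hinter : ∀ X ⊆ M.E, M.eRk X ≤ (q - 1 : ℕ) → (X.ncard : ℕ∞) ≤ M.eRk X + νi)
    {d : ℕ} (hd : M.E.encard = M.eRank + d) (h2 : d + νi < 2 * ν₁)
    (hσm : f' - q ≤ min (f - (q + 1)) (ν₁ - 2)) (hσg : f' - q ≤ min f (q + d) - (q + 1)) :
    ({B : Set α | B ⊆ M.E ∧ M.eRk B = q ∧ B.ncard ≤ d}.ncard : ℚ) ≤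
      (M.E.ncard.choose q : ℚ) +
        (∑ j ∈ Finset.range (d - (q + 1) + 1), ((min (f - (q + 1)) (ν₁ - 2)).choose j : ℚ) / (((j + 1) + 3 * (j + 1).choose 2 : ℕ) : ℚ)) *
          (∑ k ∈ Finset.Icc 3 (q + 1),
            ({C | M.IsCircuit C ∧ C.ncard = k}.ncard : ℚ) * ((M.E.ncard - k).choose (q + 1 - k) : ℚ)) +
        ((∑ j ∈ Finset.range (d - (q + 1) + 1), ((min f (q + d) - (q + 1)).choose j : ℚ) / (((j + 1) + 3 * (j + 1).choose 2 : ℕ) : ℚ)) -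
          (∑ j ∈ Finset.range (d - (q + 1) + 1), ((f' - q).choose j : ℚ) / (((j + 1) + 3 * (j + 1).choose 2 : ℕ) : ℚ))) *
          (∑ k ∈ Finset.Icc 3 (q + 1),
            ({C | M.IsCircuit C ∧ C.ncard = k}.ncard : ℚ) * ((min f (q + d) - k).choose (q + 1 - k) : ℚ)) := by
  set Ef := Matroid.groundF M with hEf
  have hE : (Ef : Set α) = M.E := Matroid.coe_groundF M
  have hEcard : Ef.card = M.E.ncard := Matroid.card_groundF M
  set S := {B : Set α | B ⊆ M.E ∧ M.eRk B = q ∧ B.ncard ≤ d} with hS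
  set S₁ := {B : Set α | B ⊆ (Ef : Set α) ∧ B.ncard = q} with hS₁
  set S₂ := {B : Set α | B ⊆ M.E ∧ M.eRk B = q ∧ q < B.ncard ∧ B.ncard ≤ d} with hS₂
  have hsplit : S ⊆ S₁ ∪ S₂ := by
    intro B hB
    have hBfin : B.Finite := M.ground_finite.subset hB.1
    have hle : q ≤ B.ncard := by
      have := M.eRk_le_encard B
      rw [hB.2.1, ← hBfin.cast_ncard_eq] at this
      exact_mod_cast this
    rcases hle.lt_or_eq with h | h
    · exact Or.inr ⟨hB.1, hB.2.1, h, hB.2.2⟩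
    · exact Or.inl ⟨by rw [hE]; exact hB.1, h.symm⟩
  have hS₁fin : S₁.Finite := (Ef.finite_toSet.finite_subsets).subset (fun B hB => hB.1)
  have hS₂fin : S₂.Finite := M.ground_finite.finite_subsets.subset (fun B hB => hB.1)
  have hS₁ : S₁.ncard = M.E.ncard.choose q := by
    rw [hS₁, ncard_subsets_ncard_eq Ef q, hEcard]
  set Ps := (Matroid.pairsSmall M q f').card with hPs
  set Pm := (Matroid.pairsMid M q f' ν₁).card with hPm
  set Pg := (Matroid.pairsGiant M q f' ν₁).card with hPg
  set Fm := min f (q + d) with hFm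
  have hlevel : ∀ m ∈ Finset.Icc (q + 1) d, ((Matroid.levelF M q m).card : ℚ) ≤
      ((Ps : ℚ) * ((f' - q).choose (m - (q + 1)) : ℚ) + (Pm : ℚ) * ((min (f - (q + 1)) (ν₁ - 2)).choose (m - (q + 1)) : ℚ) +
        (Pg : ℚ) * ((Fm - (q + 1)).choose (m - (q + 1)) : ℚ)) / (((m - q) + 3 * (m - q).choose 2 : ℕ) : ℚ) := by
    intro m hm
    rw [Finset.mem_Icc] at hm
    have hmq : 0 < m - q := by omega
    have hpos : (0 : ℚ) < (((m - q) + 3 * (m - q).choose 2 : ℕ) : ℚ) := by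
      exact_mod_cast (by omega : 0 < (m - q) + 3 * (m - q).choose 2)
    rw [le_div_iff₀ hpos]
    have h := mul_card_levelF_le_giant_three q f f' ν₁ hq hcirc hC1 hflat hd m
    have h' : ((((m - q) + 3 * (m - q).choose 2) * (Matroid.levelF M q m).card : ℕ) : ℚ) ≤
        ((Ps * (f' - q).choose (m - (q + 1)) + Pm * (min (f - (q + 1)) (ν₁ - 2)).choose (m - (q + 1)) +
          Pg * (Fm - (q + 1)).choose (m - (q + 1)) : ℕ) : ℚ) := by
      exact_mod_cast h
    push_cast at h' ⊢
    linarith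
  have hS₂q : (S₂.ncard : ℚ) ≤ ∑ m ∈ Finset.Icc (q + 1) d,
      ((Ps : ℚ) * ((f' - q).choose (m - (q + 1)) : ℚ) + (Pm : ℚ) * ((min (f - (q + 1)) (ν₁ - 2)).choose (m - (q + 1)) : ℚ) +
        (Pg : ℚ) * ((Fm - (q + 1)).choose (m - (q + 1)) : ℚ)) / (((m - q) + 3 * (m - q).choose 2 : ℕ) : ℚ) := by
    calc (S₂.ncard : ℚ) ≤ ((∑ m ∈ Finset.Icc (q + 1) d, (Matroid.levelF M q m).card : ℕ) : ℚ) := by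
          exact_mod_cast Matroid.ncard_dep_le_sum_levelF q d
      _ = ∑ m ∈ Finset.Icc (q + 1) d, ((Matroid.levelF M q m).card : ℚ) := by push_cast; rfl
      _ ≤ _ := Finset.sum_le_sum hlevel
  have hre : ∑ m ∈ Finset.Icc (q + 1) d,
      ((Ps : ℚ) * ((f' - q).choose (m - (q + 1)) : ℚ) + (Pm : ℚ) * ((min (f - (q + 1)) (ν₁ - 2)).choose (m - (q + 1)) : ℚ) +
        (Pg : ℚ) * ((Fm - (q + 1)).choose (m - (q + 1)) : ℚ)) / (((m - q) + 3 * (m - q).choose 2 : ℕ) : ℚ) =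
      ∑ j ∈ Finset.range (d - q),
      ((Ps : ℚ) * ((f' - q).choose j : ℚ) + (Pm : ℚ) * ((min (f - (q + 1)) (ν₁ - 2)).choose j : ℚ) +
        (Pg : ℚ) * ((Fm - (q + 1)).choose j : ℚ)) / (((j + 1) + 3 * (j + 1).choose 2 : ℕ) : ℚ) := by
    rw [show Finset.Icc (q + 1) d = Finset.image (fun j => q + 1 + j) (Finset.range (d - q)) from ?_]
    · rw [Finset.sum_image (fun a _ b _ h => by omega)]
      apply Finset.sum_congr rfl
      intro j _
      rw [show q + 1 + j - (q + 1) = j by omega, show q + 1 + j - q = j + 1 by omega]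
    · ext m
      rw [Finset.mem_Icc, Finset.mem_image]
      constructor
      · intro hm
        exact ⟨m - (q + 1), by rw [Finset.mem_range]; omega, by omega⟩
      · rintro ⟨j, hj, rfl⟩
        rw [Finset.mem_range] at hj
        omega
  have hrange : Finset.range (d - q) ⊆ Finset.range (d - (q + 1) + 1) := Finset.range_mono (by omega)
  have hS₂q' : (S₂.ncard : ℚ) ≤
      (Ps : ℚ) * ∑ j ∈ Finset.range (d - (q + 1) + 1), ((f' - q).choose j : ℚ) / (((j + 1) + 3 * (j + 1).choose 2 : ℕ) : ℚ) +
      (Pm : ℚ) * ∑ j ∈ Finset.range (d - (q + 1) + 1), ((min (f - (q + 1)) (ν₁ - 2)).choose j : ℚ) / (((j + 1) + 3 * (j + 1).choose 2 : ℕ) : ℚ) +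
      (Pg : ℚ) * ∑ j ∈ Finset.range (d - (q + 1) + 1), ((Fm - (q + 1)).choose j : ℚ) / (((j + 1) + 3 * (j + 1).choose 2 : ℕ) : ℚ) := by
    rw [Finset.mul_sum, Finset.mul_sum, Finset.mul_sum, ← Finset.sum_add_distrib, ← Finset.sum_add_distrib]
    refine hS₂q.trans (hre.le.trans ?_)
    refine Finset.sum_le_sum_of_subset_of_nonneg hrange (fun j _ _ => by positivity) |>.trans' ?_
    apply le_of_eq
    apply Finset.sum_congr rfl
    intro j _
    field_simp
  -- the pair counts: the partition `Ps + Pm + Pg = #pairsF ≤ P_E`, and the giant count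
  have hpart : Ps + Pm + Pg = (Matroid.pairsF M q).card := by
    have h1 : (Matroid.pairsSmall M q f').card + (Matroid.pairsBig M q f').card = (Matroid.pairsF M q).card := by
      unfold Matroid.pairsSmall Matroid.pairsBig
      exact Finset.card_filter_add_card_filter_not _
    have h2 : (Matroid.pairsGiant M q f' ν₁).card + (Matroid.pairsMid M q f' ν₁).card =
        (Matroid.pairsBig M q f').card := by
      unfold Matroid.pairsGiant Matroid.pairsMid
      exact Finset.card_filter_add_card_filter_not _
    omega
  have hFq : ((Matroid.pairsF M q).card : ℚ) ≤ ∑ k ∈ Finset.Icc 3 (q + 1),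
      ({C | M.IsCircuit C ∧ C.ncard = k}.ncard : ℚ) * ((M.E.ncard - k).choose (q + 1 - k) : ℚ) := by
    have h2 := Matroid.card_pairsF_le' (M := M) q
    have : (((Matroid.pairsF M q).card : ℕ) : ℚ) ≤ ((∑ k ∈ Finset.Icc 3 (q + 1),
        {C | M.IsCircuit C ∧ C.ncard = k}.ncard * (M.E.ncard - k).choose (q + 1 - k) : ℕ) : ℚ) := by
      exact_mod_cast h2
    push_cast at this
    exact this
  have hPgq : (Pg : ℚ) ≤ ∑ k ∈ Finset.Icc 3 (q + 1),
      ({C | M.IsCircuit C ∧ C.ncard = k}.ncard : ℚ) * ((Fm - k).choose (q + 1 - k) : ℚ) := by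
    have h2 := Matroid.card_pairsGiant_le' (M := M) (ν₁ := ν₁) hq hflat hflat' hinter hd h2
    have : ((Pg : ℕ) : ℚ) ≤ ((∑ k ∈ Finset.Icc 3 (q + 1),
        {C | M.IsCircuit C ∧ C.ncard = k}.ncard * (Fm - k).choose (q + 1 - k) : ℕ) : ℚ) := by
      exact_mod_cast h2
    push_cast at this
    exact this
  -- the weights: `σ_s ≤ σ_m`, `σ_s ≤ σ_g` termwise
  set σs : ℚ := ∑ j ∈ Finset.range (d - (q + 1) + 1), ((f' - q).choose j : ℚ) / (((j + 1) + 3 * (j + 1).choose 2 : ℕ) : ℚ) with hσs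
  set σm : ℚ := ∑ j ∈ Finset.range (d - (q + 1) + 1), ((min (f - (q + 1)) (ν₁ - 2)).choose j : ℚ) / (((j + 1) + 3 * (j + 1).choose 2 : ℕ) : ℚ)
    with hσmdef
  set σg : ℚ := ∑ j ∈ Finset.range (d - (q + 1) + 1), ((Fm - (q + 1)).choose j : ℚ) / (((j + 1) + 3 * (j + 1).choose 2 : ℕ) : ℚ) with hσgdef
  have hσs0 : (0 : ℚ) ≤ σs := Finset.sum_nonneg (fun j _ => by positivity)
  have hsm : σs ≤ σm := by
    apply Finset.sum_le_sum
    intro j _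
    have : (f' - q).choose j ≤ (min (f - (q + 1)) (ν₁ - 2)).choose j := Nat.choose_le_choose j hσm
    have h' : ((f' - q).choose j : ℚ) ≤ ((min (f - (q + 1)) (ν₁ - 2)).choose j : ℚ) := by exact_mod_cast this
    exact div_le_div_of_nonneg_right h' (by positivity)
  have hsg : σs ≤ σg := by
    apply Finset.sum_le_sum
    intro j _
    have : (f' - q).choose j ≤ (Fm - (q + 1)).choose j := Nat.choose_le_choose j hσg
    have h' : ((f' - q).choose j : ℚ) ≤ ((Fm - (q + 1)).choose j : ℚ) := by exact_mod_cast this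
    exact div_le_div_of_nonneg_right h' (by positivity)
  have hSq : (S.ncard : ℚ) ≤ (S₁.ncard : ℚ) + (S₂.ncard : ℚ) := by
    have : S.ncard ≤ S₁.ncard + S₂.ncard :=
      (ncard_le_ncard hsplit (hS₁fin.union hS₂fin)).trans (ncard_union_le _ _)
    exact_mod_cast this
  rw [hS₁] at hSq
  have hpartq : (Ps : ℚ) + Pm + Pg = ((Matroid.pairsF M q).card : ℚ) := by exact_mod_cast hpart
  have hPs0 : (0 : ℚ) ≤ Ps := Nat.cast_nonneg _
  have hPm0 : (0 : ℚ) ≤ Pm := Nat.cast_nonneg _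
  have hPg0 : (0 : ℚ) ≤ Pg := Nat.cast_nonneg _
  have hσm0 : (0 : ℚ) ≤ σm := hσs0.trans hsm
  -- `σs·Ps + σm·Pm + σg·Pg ≤ σm·(Ps + Pm + Pg) + (σg − σs)·Pg`
  have key : (Ps : ℚ) * σs + (Pm : ℚ) * σm + (Pg : ℚ) * σg ≤
      ((Matroid.pairsF M q).card : ℚ) * σm + (σg - σs) * Pg := by
    rw [← hpartq]
    nlinarith [mul_le_mul_of_nonneg_left hsm hPs0, mul_le_mul_of_nonneg_left hsm hPg0]
  have e1 := mul_le_mul_of_nonneg_right hFq hσm0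
  have e3 := mul_le_mul_of_nonneg_left hPgq (by linarith : (0 : ℚ) ≤ σg - σs)
  calc (S.ncard : ℚ) ≤ (M.E.ncard.choose q : ℚ) + (S₂.ncard : ℚ) := hSq
    _ ≤ _ := by linarith [hS₂q', key, e1, e3]

end S2

end PercRepro
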